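import Summits.QuantumFields.BalabanUV.T4Continuum.Support.NE7LyapunovTensor
import Summits.QuantumFields.BalabanUV.T4Continuum.Support.AveragingDeficitTorusChart
import HarnessLib

/-!
# NE7LyapunovTorusBridge — STENCIL FORMS ON PERIODIC LATTICE FIELDS: the period-box evaluation `formEvalP`, the transport `ℤ^d ⊃ [0,N)^d ↔ (ℤ∕N)^d` of fields, stencils and forms,
# and the FOUR-FOLD LYAPUNOV TENSOR INEQUALITY ✓ `lyapunov_tensor4_le` READ ON `N`-PERIODIC FIELDS OF `ℤ⁴`: `(⊗_μ A^{(κ)}_μ)(v) ≤ 3·(17∕8)³·(⊗_μ B_μ)(v)` with period-box sums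
# (lineage `b2b-balaban-t4-ne7b-p1`, gen 163; route (H′), memo `t4/b2b-balaban-t4-ne7b-p1/g162/records/SCOPING-LEVELMASSES.md` §12, file (R3b), first part)

Cell `pub-balaban`, rung (B)+1 sub-cell t4, lineage `b2b-balaban-t4-ne7b-p1` (row NE7b OWNER + CRUX PROVER; junction service for row NE7 on ROAD-G116 §6 (G3) ∕ the ℓ² route to (G′)),
generation 163.
WHY.  ✓ `NE7StencilForms` ∕ ✓ `NE7LyapunovTensor` prove the Lyapunov inequalities of the exact lift's main part on every FINITE abelian group (`formEval` sums over the whole group).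
The lift itself (✓ `NE7WhitneyExactLiftFlat`) lives on `N`-periodic fields of the lattice `ℤ^d = Site d`, with masses summed over the period box `[0,N)^d` (✓ `periodBox`).  THIS FILE is
the dictionary: the period-box evaluation `formEvalP N F v` of a stencil form, the transport of fields (`toTorus N v r = v (boxVec N r)`), of stencils and of forms along the reduction
`redN N : ℤ^d → [0,N)^d = (ℤ∕N)^d` (✓ `AveragingDeficitTorusChart.redN`, here packaged as the additive map `redHom`), the identity `formEvalP N F v = formEval (mapForm N F) (toTorus N v)`
for periodic `v`, compatibility with `formProd` and with the named stencils∕forms of ✓ `NE7LyapunovTensor`, and the consequence: ✓ `lyapunov_tensor4_le` for periodic fields on `ℤ⁴`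
with period-box sums (memo §12 (R3b), the bridge).
WHAT ([folklore]; DATA defs `formEvalP`, `redHom`, `toTorus`, `mapStencil`, `mapForm`; 0 sorry; `X` any real inner product space):
§1 `formEvalP`, `formEvalP_nonneg`, `act_periodic` (stencil images of periodic fields are periodic);
§2 `redHom` (`redN` is additive), `toTorus`, **`toTorus_redN`** (`toTorus N v (redN N y) = v y` for `N`-periodic `v`), `mapStencil`, `mapForm`, **`act_mapStencil`**
   (`act (mapStencil N s) (toTorus N v) (redN N y) = act s v y`), `sum_periodBox_redN` (`Σ_{y∈[0,N)^d} g (redN N y) = Σ_r g r`), **`formEvalP_eq_formEval`**, `mapForm_formProd`,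
   `mapStencil_delta4` … `mapStencil_lapI4`, `mapForm_Aflat`, `mapForm_Atent`, `mapForm_Bform`;
§3 **`lyapunov_tensor4_periodic`**: for `N ≥ 1`, `κ : Fin 4` and an `N`-periodic `v : Site 4 → X`, with `A μ = Aflat (e μ)` if `μ = κ` else `Atent (e μ)`,
   `formEvalP N (A 0 ⊗ A 1 ⊗ A 2 ⊗ A 3) v ≤ 3·(17∕8)³ · formEvalP N (Bform (e 0) ⊗ ⋯ ⊗ Bform (e 3)) v`.
WHAT IS NOT HERE: the identification of the two sides with the fine∕coarse Lyapunov forms of the lift (cell table — next file), the level iteration, the gauge part, (C).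
HONEST FRAMING (page 1): elementary bookkeeping about OUR objects; nothing of Bałaban's asserted; NOT (C), NOT (G3), NOT (G′), NOT NE7∕NE3 as spine nodes; row NE7b NOT PRINTED ∕ NOT PROVED;
spine 0∕9; finite T⁴ rung (B)+1 — NOT infinite volume, NOT mass gap, NOT BetaPertH, NOT Clay.
-/

set_option autoImplicit false

open scoped BigOperators RealInnerProductSpace
open Finset

namespace Summit.QuantumFields.BalabanUV.T4Continuum.NE7LyapunovTorusBridge

open Literature.MathematicalPhysics.QuantumFieldTheory.Balaban1983to89
open B7Prop1Explicit
open T4AveragingDeficitWallBoundary (periodBox mem_periodBox)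
open AveragingDeficitTorusChart (redN coe_redN redN_boxVec boxVec_redN eq_wrap_add periodic_smul_vec)
open NE7StencilForms (act conv formEval formProd formEval_nonneg)
open NE7LyapunovTensor (delta4 grad4 bst4 gradb4 lapb4 mid4 hgrad4 lapI4 Aflat Atent Bform Bform_nonneg lyapunov_tensor4_le)

noncomputable section

variable {d : ℕ}
variable {X : Type*} [NormedAddCommGroup X] [InnerProductSpace ℝ X]

/-! ## §1 The period-box evaluation of a stencil form on lattice fields -/

/-- **THE PERIOD-BOX EVALUATION** of a sum-of-squares stencil form `F` (coefficients `(F i).1`, stencils `(F i).2 : κ → ℝ × ℤ^d`) at a lattice field `v : ℤ^d → X`: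
`formEvalP N F v = Σ_i (F i).1 · Σ_{y ∈ [0,N)^d} ‖act (F i).2 v y‖²`. [folklore] -/
def formEvalP {ι κ : Type*} [Fintype ι] [Fintype κ] (N : ℕ) (F : ι → ℝ × (κ → ℝ × Site d)) (v : Site d → X) : ℝ :=
  ∑ i, (F i).1 * ∑ y ∈ periodBox (d := d) N, ‖act (F i).2 v y‖ ^ 2

section Basic

variable {ι κ : Type*} [Fintype ι] [Fintype κ]

/-- A form with nonnegative coefficients has a nonnegative period-box evaluation. [folklore] -/
theorem formEvalP_nonneg (N : ℕ) (F : ι → ℝ × (κ → ℝ × Site d)) (hF : ∀ i, 0 ≤ (F i).1) (v : Site d → X) : 0 ≤ formEvalP N F v :=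
  Finset.sum_nonneg fun i _ => mul_nonneg (hF i) (Finset.sum_nonneg fun _ _ => by positivity)

/-- The stencil image of an `N`-periodic field is `N`-periodic. [folklore] -/
theorem act_periodic (s : κ → ℝ × Site d) {v : Site d → X} {P : ℤ} (hv : ∀ (y : Site d) (j : Fin d), v (y + P • e j) = v y)
    (y : Site d) (j : Fin d) : act s v (y + P • e j) = act s v y := by
  simp only [act, add_right_comm _ (P • e j), hv]

end Basic

/-! ## §2 Transport to the torus `(ℤ∕N)^d = Fin d → Fin N` -/

section Torus

variable (N : ℕ) [NeZero N]

/-- **`redN` IS ADDITIVE**: the reduction `ℤ^d → (ℤ∕N)^d` as an additive monoid homomorphism. [folklore] -/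
def redHom : Site d →+ (Fin d → Fin N) where
  toFun := redN N
  map_zero' := by
    funext i
    apply Fin.ext
    have h := coe_redN N (0 : Site d) i
    simp only [Pi.zero_apply, Int.zero_emod, Nat.cast_eq_zero] at h
    rw [h]; rfl
  map_add' := by
    intro x y
    funext i
    apply Fin.ext
    have hxy := coe_redN N (x + y) i
    have hx := coe_redN N x i
    have hy := coe_redN N y i
    have hN : (0 : ℤ) < N := by exact_mod_cast Nat.pos_of_ne_zero (NeZero.ne N)
    rw [Pi.add_apply, Fin.val_add]
    have h2 : (((redN N x i : ℕ) + (redN N y i : ℕ)) % N : ℕ) = ((x i + y i) % (N : ℤ)).toNat := by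
      have h3 : ((((redN N x i : ℕ) + (redN N y i : ℕ)) % N : ℕ) : ℤ) = (x i + y i) % (N : ℤ) := by
        push_cast
        rw [hx, hy, ← Int.add_emod]
      have h4 : 0 ≤ (x i + y i) % (N : ℤ) := Int.emod_nonneg _ hN.ne'
      omega
    have h5 : (redN N (x + y) i : ℕ) = ((x i + y i) % (N : ℤ)).toNat := by
      have h4 : 0 ≤ (x i + y i) % (N : ℤ) := Int.emod_nonneg _ hN.ne'
      simp only [Pi.add_apply] at hxy
      omega
    rw [h5, h2]

/-- `redHom N x = redN N x`. [folklore] -/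
@[simp] theorem redHom_apply (x : Site d) : redHom (d := d) N x = redN N x := rfl

/-- `redN` of a sum. [folklore] -/
theorem redN_add (x y : Site d) : redN N (x + y) = redN N x + redN N y := (redHom (d := d) N).map_add x y

/-- `redN N 0 = 0`. [folklore] -/
theorem redN_zero : redN N (0 : Site d) = 0 := (redHom (d := d) N).map_zero

/-- **TRANSPORT OF A LATTICE FIELD TO THE TORUS**: `toTorus N v r = v (boxVec N r)` (the restriction to the period box, read on the torus index). [folklore] -/
def toTorus {Y : Type*} (v : Site d → Y) : (Fin d → Fin N) → Y := fun r => v (boxVec N r)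

omit [NormedAddCommGroup X] [InnerProductSpace ℝ X] in
/-- **For an `N`-periodic field, `toTorus N v (redN N y) = v y`** (the wrap `boxVec (redN y)` differs from `y` by a period vector). [folklore] -/
theorem toTorus_redN {Y : Type*} {v : Site d → Y} (hv : ∀ (y : Site d) (j : Fin d), v (y + (N : ℤ) • e j) = v y) (y : Site d) :
    toTorus N v (redN N y) = v y := by
  unfold toTorus
  have h := eq_wrap_add N y
  conv_rhs => rw [h]
  exact (periodic_smul_vec hv _ _).symm

/-- **TRANSPORT OF A STENCIL**: same coefficients, shifts reduced modulo `N`. [folklore] -/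
def mapStencil {κ : Type*} (s : κ → ℝ × Site d) : κ → ℝ × (Fin d → Fin N) := fun k => ((s k).1, redN N (s k).2)

/-- **TRANSPORT OF A FORM**: same coefficients, stencils transported. [folklore] -/
def mapForm {ι κ : Type*} (F : ι → ℝ × (κ → ℝ × Site d)) : ι → ℝ × (κ → ℝ × (Fin d → Fin N)) := fun i => ((F i).1, mapStencil N (F i).2)

variable {ι κ ι' κ' : Type*} [Fintype ι] [Fintype κ] [Fintype ι'] [Fintype κ']

/-- **THE STENCIL ACTION COMMUTES WITH THE TRANSPORT** (periodic `v`): `act (mapStencil N s) (toTorus N v) (redN N y) = act s v y`. [folklore] -/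
theorem act_mapStencil (s : κ → ℝ × Site d) {v : Site d → X} (hv : ∀ (y : Site d) (j : Fin d), v (y + (N : ℤ) • e j) = v y) (y : Site d) :
    act (mapStencil N s) (toTorus N v) (redN N y) = act s v y := by
  unfold act mapStencil
  refine Finset.sum_congr rfl fun k _ => ?_
  rw [← redN_add, toTorus_redN N hv]

/-- **PERIOD-BOX SUMS ARE TORUS SUMS**: `Σ_{y ∈ [0,N)^d} g (redN N y) = Σ_r g r`. [folklore] -/
theorem sum_periodBox_redN {β : Type*} [AddCommMonoid β] (g : (Fin d → Fin N) → β) :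
    ∑ y ∈ periodBox (d := d) N, g (redN N y) = ∑ r, g r := by
  unfold periodBox
  have hinj : Function.Injective (boxVec (d := d) N) := fun r r' h =>
    funext fun κ => Fin.ext (by have := congr_fun h κ; simp only [boxVec, Nat.cast_inj] at this; exact this)
  rw [Finset.sum_image fun a _ b _ h => hinj h]
  exact Finset.sum_congr rfl fun r _ => by rw [redN_boxVec]

/-- **`formEvalP N F v = formEval (mapForm N F) (toTorus N v)`** for an `N`-periodic field `v`. [folklore] -/
theorem formEvalP_eq_formEval (F : ι → ℝ × (κ → ℝ × Site d)) {v : Site d → X} (hv : ∀ (y : Site d) (j : Fin d), v (y + (N : ℤ) • e j) = v y) :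
    formEvalP N F v = formEval (mapForm N F) (toTorus N v) := by
  unfold formEvalP formEval
  refine Finset.sum_congr rfl fun i _ => ?_
  show (F i).1 * ∑ y ∈ periodBox (d := d) N, ‖act (F i).2 v y‖ ^ 2 = (F i).1 * ∑ r, ‖act (mapStencil N (F i).2) (toTorus N v) r‖ ^ 2
  congr 1
  rw [← sum_periodBox_redN N (fun r => ‖act (mapStencil N (F i).2) (toTorus N v) r‖ ^ 2)]
  exact Finset.sum_congr rfl fun y _ => by rw [act_mapStencil N _ hv]

omit [Fintype ι] [Fintype κ] [Fintype ι'] [Fintype κ'] in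
/-- The transport commutes with the product of forms (shifts add, `redN` is additive). [folklore] -/
theorem mapForm_formProd (F : ι → ℝ × (κ → ℝ × Site d)) (F' : ι' → ℝ × (κ' → ℝ × Site d)) :
    mapForm N (formProd F F') = formProd (mapForm N F) (mapForm N F') := by
  funext p
  refine Prod.ext rfl ?_
  funext q
  simp only [mapForm, formProd, mapStencil, conv, redN_add]

omit [Fintype ι] [Fintype κ] [Fintype ι'] [Fintype κ'] in
/-- `mapForm` of an `if`. [folklore] -/
theorem mapForm_ite (p : Prop) [Decidable p] (F G : ι → ℝ × (κ → ℝ × Site d)) :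
    mapForm N (if p then F else G) = if p then mapForm N F else mapForm N G := by
  split_ifs <;> rfl

/-! ### The named stencils and forms of ✓ `NE7LyapunovTensor` are transported to themselves at the reduced step -/

/-- `mapStencil N (delta4 a) = delta4 (redN N a)`. [folklore] -/
theorem mapStencil_delta4 (a : Site d) : mapStencil N (delta4 a) = delta4 (redN N a) := by
  funext k; fin_cases k <;> simp [mapStencil, delta4, redN_zero]
/-- `mapStencil N (grad4 a) = grad4 (redN N a)`. [folklore] -/
theorem mapStencil_grad4 (a : Site d) : mapStencil N (grad4 a) = grad4 (redN N a) := by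
  funext k; fin_cases k <;> simp [mapStencil, grad4, redN_zero]
/-- `mapStencil N (bst4 a) = bst4 (redN N a)`. [folklore] -/
theorem mapStencil_bst4 (a : Site d) : mapStencil N (bst4 a) = bst4 (redN N a) := by
  funext k; fin_cases k <;> simp [mapStencil, bst4, redN_zero]
/-- `mapStencil N (gradb4 a) = gradb4 (redN N a)`. [folklore] -/
theorem mapStencil_gradb4 (a : Site d) : mapStencil N (gradb4 a) = gradb4 (redN N a) := by
  funext k; fin_cases k <;> simp [mapStencil, gradb4, redN_zero, redN_add]
/-- `mapStencil N (lapb4 a) = lapb4 (redN N a)`. [folklore] -/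
theorem mapStencil_lapb4 (a : Site d) : mapStencil N (lapb4 a) = lapb4 (redN N a) := by
  funext k; fin_cases k <;> simp [mapStencil, lapb4, redN_zero, redN_add]
/-- `mapStencil N (mid4 a) = mid4 (redN N a)`. [folklore] -/
theorem mapStencil_mid4 (a : Site d) : mapStencil N (mid4 a) = mid4 (redN N a) := by
  funext k; fin_cases k <;> simp [mapStencil, mid4, redN_zero]
/-- `mapStencil N (hgrad4 a) = hgrad4 (redN N a)`. [folklore] -/
theorem mapStencil_hgrad4 (a : Site d) : mapStencil N (hgrad4 a) = hgrad4 (redN N a) := by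
  funext k; fin_cases k <;> simp [mapStencil, hgrad4, redN_zero]
/-- `mapStencil N (lapI4 a) = lapI4 (redN N a)`. [folklore] -/
theorem mapStencil_lapI4 (a : Site d) : mapStencil N (lapI4 a) = lapI4 (redN N a) := by
  funext k; fin_cases k <;> simp [mapStencil, lapI4, redN_zero, redN_add]

/-- `mapForm N (Aflat a) = Aflat (redN N a)`. [folklore] -/
theorem mapForm_Aflat (a : Site d) : mapForm N (Aflat a) = Aflat (redN N a) := by
  funext i; fin_cases i <;> simp [mapForm, Aflat, mapStencil_delta4, mapStencil_grad4]
/-- `mapForm N (Atent a) = Atent (redN N a)`. [folklore] -/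
theorem mapForm_Atent (a : Site d) : mapForm N (Atent a) = Atent (redN N a) := by
  funext i; fin_cases i <;> simp [mapForm, Atent, mapStencil_delta4, mapStencil_mid4, mapStencil_hgrad4, mapStencil_lapI4]
/-- `mapForm N (Bform a) = Bform (redN N a)`. [folklore] -/
theorem mapForm_Bform (a : Site d) : mapForm N (Bform a) = Bform (redN N a) := by
  funext i; fin_cases i <;> simp [mapForm, Bform, mapStencil_bst4, mapStencil_gradb4, mapStencil_lapb4]

end Torus

/-! ## §3 The four-fold Lyapunov tensor inequality for periodic fields on `ℤ⁴` -/

/-- **THE FOUR-FOLD LYAPUNOV TENSOR INEQUALITY ON `N`-PERIODIC FIELDS OF `ℤ⁴`** (`N ≥ 1`, longitudinal direction `κ`): with `A μ = Aflat (e μ)` for `μ = κ` and `Atent (e μ)` otherwise,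
`formEvalP N (A 0 ⊗ A 1 ⊗ A 2 ⊗ A 3) v ≤ 3·(17∕8)³ · formEvalP N (Bform (e 0) ⊗ Bform (e 1) ⊗ Bform (e 2) ⊗ Bform (e 3)) v` — ✓ `lyapunov_tensor4_le` on the torus `(ℤ∕N)⁴`, transported. [folklore] -/
theorem lyapunov_tensor4_periodic {N : ℕ} (hN : 1 ≤ N) (κ : Fin 4) {v : Site 4 → X} (hv : ∀ (y : Site 4) (j : Fin 4), v (y + (N : ℤ) • e j) = v y) :
    formEvalP N (formProd (formProd (formProd
        (if (0 : Fin 4) = κ then Aflat (e (0 : Fin 4)) else Atent (e (0 : Fin 4))) (if (1 : Fin 4) = κ then Aflat (e (1 : Fin 4)) else Atent (e (1 : Fin 4))))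
        (if (2 : Fin 4) = κ then Aflat (e (2 : Fin 4)) else Atent (e (2 : Fin 4)))) (if (3 : Fin 4) = κ then Aflat (e (3 : Fin 4)) else Atent (e (3 : Fin 4)))) v
      ≤ (3 * (17 / 8 : ℝ) ^ 3) * formEvalP N (formProd (formProd (formProd (Bform (e (0 : Fin 4))) (Bform (e (1 : Fin 4)))) (Bform (e (2 : Fin 4)))) (Bform (e (3 : Fin 4)))) v := by
  haveI : NeZero N := ⟨by omega⟩
  rw [formEvalP_eq_formEval N _ hv, formEvalP_eq_formEval N _ hv]
  simp only [mapForm_formProd, mapForm_ite, mapForm_Aflat, mapForm_Atent, mapForm_Bform]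
  exact lyapunov_tensor4_le (fun μ => redN N (e μ)) κ (toTorus N v)

end

end Summit.QuantumFields.BalabanUV.T4Continuum.NE7LyapunovTorusBridge
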